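/-
COR-CM (cell pub-hodgecm2, stage 2 of the Hodge ladder) — count-neutral KERNEL COMBINATORICS «dicyclic twist: transport of the count to the intrinsic currency»
(seat prover-pub-hodgecm2-b23-g42-0, binder prover b23, gen 42; claim DICYCLIC-COLUMN, HOME/INBOX.md l.10328).
Bookkeeping definitions with bodies (`tr`, `gfOf`, `blockEquiv`) + theorems, on top of the intrinsic currency (`CorCM/Prior/AllgGroup1.lean`,
`Census/BlockParityLaw.lean`, `Census/CoinvariantFibre.lean`) and the lane `Census/DicyclicTwist*` used BY NAME; no `decide` table, no certificate, no named
fact, no `sorry`; `Interfaces.lean` (C1), every E term, B01, `Transposition/*`, `PortJoin/*` untouched.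
HONEST FRAMING: `HC_CM` is NOT proved, here or anywhere in the tree; nothing here is a period, a count of record or a headline.
T5: n/a-class (hypothesis binders: the dicyclic datum `D`, `c * c = 1`, `|A|` odd, `3 ≤ |A|`); checker: self, 2026-08-23.
-/
import Summits.HodgeConjecture.CorCM.Census.DicyclicTwistPlaces
import Summits.HodgeConjecture.CorCM.Census.DicyclicTwistCount
import Summits.HodgeConjecture.CorCM.Census.CoinvariantFibre
import Summits.HodgeConjecture.CorCM.Census.BlockParityTransfer

/-!
# The dicyclic twist, transport: `μ(G, c) ≤ β(G, c) − 1` for every `(G, c)` carrying a dicyclic datum over an abelian group of odd order `≥ 3`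

Along a dicyclic datum `D` on `(G, c)` over `A` (`Census/DicyclicTwistDictionary.lean`: `typeEquiv D : CMF G c ≃ Ty₂ A`) the linear transport
**`tr D : ℤ^{Ty₂ A} ≃ₗ ℤ[CMF G c]`**, `e_Ψm ↦ [typeOf Ψm]`, carries
* §2 the model's pairs to the pairs of the intrinsic currency (`tr_pairVec₂`, `map_pairs₂`);
* §3 the model's motions to base change: `tr (h_a · v) = (tr v)·(ι a)⁻¹`, `tr (x · v) = (tr v)·x⁻¹` (`tr_translH`, `tr_translX`);
* §4 the model's rank-four face classes to abstract faces PLUS TWO PAIRS (`tr_faceVec₀`, `tr_faceVec₁`, `tr_faceVecM`, `tr_faceVecM'`: the model's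
  face classes are the positive forms `[Φ] + [Φ̄^{(t)}] + [Φ̄^{(t')}] + [Φ^{(tt')}]`, the currency's `gface` the signed forms), so that **every abstract
  face `gface Φ t t'` (`t' ∉ {t, ct}`) is a transported Hodge vector of the model up to pairs** (`gface_mem`);
* §5 the model's blocks to the blocks of `(G, c)` (**`blockEquiv`**, `card_block_eq`: `β(G, c) = #Block A`).
§6 THE TRANSPORTED COUNT (**`exists_gfaces_generate`**): from part XI (`Census/DicyclicTwistCount.lean`: `family`, `card_family_add_one_le`,
`sup_familySpan_eq_hodge₂`, `family_shape`), for `|A|` odd `≥ 3` there is a finite set `S' ⊆ gfaceSet G c` of abstract rank-four faces with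
**`|S'| + 1 ≤ β(G, c) = #Block c`** whose base changes, together with the pairs, span `hodgeSpan c` — in the census dictionary: the Hodge ring of the
whole slice of a Galois CM field with group `Dic(ℤ/2 × A, c)` is generated, modulo divisor classes, by the Galois conjugates of `β − 1` rank-four face
classes (atlas rows `Dic₃`: `β = 6`, `μ = 5`; `Dic₅`: `β = 52`, `μ = 51`; here for EVERY odd abelian `A`).
§7 THE FLOOR AND THE LAW: seat b09's block-parity floor (`Census/BlockParityRelations.lean` `card_block_le_card_add`, transfer form
`Census/BlockParityTransfer.lean` `wdelta_eq_zero_of_pow_ne_one` — the twisting element has `x^{|G|/2} = c^{|A|} = c ≠ 1`, `x_pow_ne_one`) gives `β(G, c) ≤ |S| + 1` for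
EVERY family `S` whose base changes generate the faces modulo pairs; so the least size is EXACTLY `β(G, c) − 1`
(**`isLeast_card_gfaces_generate`**: the dicyclic law `μ(G, c) = β(G, c) − 1`).  The field-level reading (`CorCM/FaceDicyclicTwistGeneration.lean`) is the
sequel.  All [folklore].

## References
* [Pohlmann1968] H. Pohlmann, Algebraic cycles on abelian varieties of complex multiplication type, Ann. of Math. 88 (1968), Thm 1.
* [Milne1999] J. S. Milne, Lefschetz motives and the Tate conjecture, Compositio Math. 117 (1999), Prop. 2.1, p. 54.
-/

namespace Summit.HodgeConjecture.CorCM.Census.DicyclicTwist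

open Finset
open Summit.HodgeConjecture.CorCM.Prior.AllgGroup.RfwfAllgGroup
open Summit.HodgeConjecture.CorCM.Census.BlockParity
open Summit.HodgeConjecture.CorCM.Census.Coinvariant
open Summit.HodgeConjecture.CorCM.Census.OddSliceFacesModel

noncomputable section

variable {G : Type*} [Group G] [Fintype G] [DecidableEq G] {c : G}
variable {A : Type} [AddCommGroup A] [Fintype A] [DecidableEq A]
variable (D : Datum G c A)

/-! ## §1 The transport isomorphism -/

/-- **The transport** `e_Ψm ↦ [typeOf Ψm]` of exponent vectors of the model to integer combinations of abstract CM types. [folklore] -/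
def tr : (Ty₂ A → ℤ) ≃ₗ[ℤ] (CMF G c →₀ ℤ) :=
  (Finsupp.linearEquivFunOnFinite ℤ ℤ (Ty₂ A)).symm ≪≫ₗ Finsupp.domLCongr (typeEquiv D).symm

omit [DecidableEq A] in
/-- **Unit vectors go to types**: `tr (n·e_Ψm) = n·[typeOf Ψm]`. [folklore] -/
@[simp] theorem tr_single (Ψm : Ty₂ A) (n : ℤ) : tr D (Pi.single Ψm n) = Finsupp.single (typeOf D Ψm) n := by
  rw [tr, LinearEquiv.trans_apply, Finsupp.linearEquivFunOnFinite_symm_single, Finsupp.domLCongr_single, typeEquiv_symm_apply]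

/-- A vector is the sum of its transported unit vectors. [folklore] -/
theorem tr_eq_sum (v : Ty₂ A → ℤ) : tr D v = ∑ Ψm, Finsupp.single (typeOf D Ψm) (v Ψm) := by
  conv_lhs => rw [← Finset.univ_sum_single v]
  rw [map_sum]
  exact Finset.sum_congr rfl fun Ψm _ => tr_single D Ψm (v Ψm)

/-! ## §2 Pairs -/

omit [DecidableEq A] in
/-- **Pairs go to pairs**: `tr (e_Ψm + e_{Ψ̄m}) = [typeOf Ψm] + [typeOf Ψm · c]`. [folklore] -/
theorem tr_pairVec₂ (Ψm : Ty₂ A) : tr D (pairVec₂ A Ψm) = pair c (typeOf D Ψm) := by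
  rw [pairVec₂, map_add, tr_single, tr_single, pair, typeOf_conj]

omit [DecidableEq A] in
/-- **The divisor lattices agree**: `tr (pairs₂ A) = ℤ⟨pairSet c⟩`. [folklore] -/
theorem map_pairs₂ : (pairs₂ A).map (tr D : (Ty₂ A → ℤ) →ₗ[ℤ] (CMF G c →₀ ℤ)) = Submodule.span ℤ (pairSet c) := by
  rw [pairs₂, Submodule.map_span, ← Set.range_comp]
  have h : ((tr D : (Ty₂ A → ℤ) →ₗ[ℤ] (CMF G c →₀ ℤ)) ∘ pairVec₂ A) = pair c ∘ typeOf D :=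
    funext fun Ψm => by rw [Function.comp_apply, Function.comp_apply, LinearEquiv.coe_coe, tr_pairVec₂]
  have hsurj : Function.Surjective (typeOf (c := c) D) := (typeEquiv D).symm.surjective
  rw [h, hsurj.range_comp]
  rfl

omit [Fintype A] [DecidableEq A] in
include D in
/-- Base change of a pair is a pair: `(pair Ψ)·Q⁻¹ = pair (Ψ·Q⁻¹)` (`c` central). [folklore] -/
theorem mapDomain_rt_pair (Q : G) (Ψ : CMF G c) : Finsupp.mapDomain (rt c Q) (pair c Ψ) = pair c (rt c Q Ψ) := by
  rw [pair, Finsupp.mapDomain_add, Finsupp.mapDomain_single, Finsupp.mapDomain_single, pair, ← rt_mul, ← rt_mul, mul_c_comm D Q]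

omit [Fintype A] [DecidableEq A] in
include D in
/-- **`ℤ⟨pairSet⟩` is base-change stable.** [folklore] -/
theorem mapDomain_rt_mem_span_pairSet (Q : G) {p : CMF G c →₀ ℤ} (hp : p ∈ Submodule.span ℤ (pairSet c)) :
    Finsupp.mapDomain (rt c Q) p ∈ Submodule.span ℤ (pairSet c) := by
  have hmap : Submodule.map (Finsupp.lmapDomain ℤ ℤ (rt c Q)) (Submodule.span ℤ (pairSet c)) ≤ Submodule.span ℤ (pairSet c) := by
    rw [Submodule.map_span, Submodule.span_le]
    rintro _ ⟨z, ⟨Ψ, rfl⟩, rfl⟩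
    exact Submodule.subset_span ⟨rt c Q Ψ, by rw [Finsupp.lmapDomain_apply]; exact (mapDomain_rt_pair D Q Ψ).symm⟩
  have h := hmap (Submodule.mem_map_of_mem (f := Finsupp.lmapDomain ℤ ℤ (rt c Q)) hp)
  rwa [Finsupp.lmapDomain_apply] at h

/-! ## §3 Motions are base changes -/

/-- **`tr (h_a · v) = (tr v)·(ι a)⁻¹`.** [folklore] -/
theorem tr_translH (a : ZMod 2 × A) (v : Ty₂ A → ℤ) : tr D (translH A a v) = Finsupp.mapDomain (rt c (D.ι a)) (tr D v) := by
  have hv : translH A a v = translHHom A a (∑ Ψm, Pi.single Ψm (v Ψm)) := by rw [translHHom_apply, Finset.univ_sum_single]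
  rw [hv, map_sum, map_sum, tr_eq_sum D v, Finsupp.mapDomain_finsetSum]
  refine Finset.sum_congr rfl fun Ψm _ => ?_
  rw [translHHom_apply, translH_single, tr_single, typeOf_twH, Finsupp.mapDomain_single]

/-- **`tr (x · v) = (tr v)·x⁻¹`.** [folklore] -/
theorem tr_translX (v : Ty₂ A → ℤ) : tr D (translX A v) = Finsupp.mapDomain (rt c D.x) (tr D v) := by
  have hv : translX A v = translXHom A (∑ Ψm, Pi.single Ψm (v Ψm)) := by rw [translXHom_apply, Finset.univ_sum_single]
  rw [hv, map_sum, map_sum, tr_eq_sum D v, Finsupp.mapDomain_finsetSum]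
  refine Finset.sum_congr rfl fun Ψm _ => ?_
  rw [translXHom_apply, translX_single, tr_single, typeOf_twX, Finsupp.mapDomain_single]

/-- `tr (h_a · x · v) = (tr v)·(ι a · x)⁻¹`. [folklore] -/
theorem tr_translH_translX (a : ZMod 2 × A) (v : Ty₂ A → ℤ) :
    tr D (translH A a (translX A v)) = Finsupp.mapDomain (rt c (D.ι a * D.x)) (tr D v) := by
  rw [tr_translH, tr_translX, ← Finsupp.mapDomain_comp]
  congr 1
  funext Ψ
  exact (rt_mul c _ _ Ψ).symm

/-! ## §4 Faces: the model's face classes are abstract faces plus two pairs -/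

/-- **`0`-coordinate faces**: `tr (φ; i, j | ψ) = gface (typeOf (φ,ψ)) (ι a) (ι b) + pair + pair` (`a.2 = i`, `b.2 = j`). [folklore] -/
theorem tr_faceVec₀ (hc2 : c * c = 1) (a b : ZMod 2 × A) (φ ψ : Ty A) :
    tr D (faceVec₀ A φ a.2 b.2 ψ) = gface c hc2 (typeOf D (φ, ψ)) (D.ι a) (D.ι b) +
      pair c (typeOf D (φ + δ A a.2, ψ)) + pair c (typeOf D (φ + δ A b.2, ψ)) := by
  rw [faceVec₀, map_add, map_add, map_add, tr_single, tr_single, tr_single, tr_single, gface, pair, pair, oflipCM_ι_typeOf,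
    oflipCM_ι_typeOf, oflipCM_ι_typeOf, ← typeOf_conj, ← typeOf_conj]
  simp only [conj, add_right_comm φ 1 (δ A _), add_right_comm φ (δ A b.2) (δ A a.2)]
  abel

/-- **`1`-coordinate faces**: `tr (ψ | φ; i, j) = gface (typeOf (ψ,φ)) (x·ι a) (x·ι b) + pair + pair`. [folklore] -/
theorem tr_faceVec₁ (hc2 : c * c = 1) (a b : ZMod 2 × A) (ψ φ : Ty A) :
    tr D (faceVec₁ A ψ φ a.2 b.2) = gface c hc2 (typeOf D (ψ, φ)) (D.x * D.ι a) (D.x * D.ι b) +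
      pair c (typeOf D (ψ, φ + δ A a.2)) + pair c (typeOf D (ψ, φ + δ A b.2)) := by
  rw [faceVec₁, map_add, map_add, map_add, tr_single, tr_single, tr_single, tr_single, gface, pair, pair, oflipCM_xι_typeOf,
    oflipCM_xι_typeOf, oflipCM_xι_typeOf, ← typeOf_conj, ← typeOf_conj]
  simp only [conj, add_right_comm φ 1 (δ A _), add_right_comm φ (δ A b.2) (δ A a.2)]
  abel

/-- **Mixed faces**: `tr (φ; i | ψ; j) = gface (typeOf (φ,ψ)) (ι a) (x·ι b) + pair + pair`. [folklore] -/
theorem tr_faceVecM (hc2 : c * c = 1) (a b : ZMod 2 × A) (φ ψ : Ty A) :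
    tr D (faceVecM A φ a.2 ψ b.2) = gface c hc2 (typeOf D (φ, ψ)) (D.ι a) (D.x * D.ι b) +
      pair c (typeOf D (φ + δ A a.2, ψ)) + pair c (typeOf D (φ, ψ + δ A b.2)) := by
  rw [faceVecM, map_add, map_add, map_add, tr_single, tr_single, tr_single, tr_single, gface, pair, pair, oflipCM_xι_typeOf,
    oflipCM_ι_typeOf, oflipCM_ι_typeOf, ← typeOf_conj, ← typeOf_conj]
  simp only [conj, add_right_comm φ 1 (δ A _), add_right_comm ψ 1 (δ A _)]
  abel

/-- Mixed faces with the places in the other order: `gface (typeOf (φ,ψ)) (x·ι b) (ι a)`. [folklore] -/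
theorem tr_faceVecM' (hc2 : c * c = 1) (a b : ZMod 2 × A) (φ ψ : Ty A) :
    tr D (faceVecM A φ a.2 ψ b.2) = gface c hc2 (typeOf D (φ, ψ)) (D.x * D.ι b) (D.ι a) +
      pair c (typeOf D (φ + δ A a.2, ψ)) + pair c (typeOf D (φ, ψ + δ A b.2)) := by
  rw [faceVecM, map_add, map_add, map_add, tr_single, tr_single, tr_single, tr_single, gface, pair, pair, oflipCM_ι_typeOf,
    oflipCM_xι_typeOf, oflipCM_xι_typeOf, ← typeOf_conj, ← typeOf_conj]
  simp only [conj, add_right_comm φ 1 (δ A _), add_right_comm ψ 1 (δ A _)]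
  abel

/-- **Every abstract face is a transported Hodge vector of the model up to two pairs.** [folklore] -/
theorem gface_mem (hc2 : c * c = 1) (Φ : CMF G c) {t t' : G} (ht' : t' ∉ orb c t) :
    gface c hc2 Φ t t' ∈ (hodge₂ A).map (tr D : (Ty₂ A → ℤ) →ₗ[ℤ] (CMF G c →₀ ℤ)) ⊔ Submodule.span ℤ (pairSet c) := by
  have hΦ : Φ = typeOf D ((ty D Φ).1, (ty D Φ).2) := by rw [Prod.mk.eta, typeOf_ty]
  have hP : ∀ Ψ : CMF G c, pair c Ψ ∈ Submodule.span ℤ (pairSet c) := fun Ψ => Submodule.subset_span (pair_mem_pairSet c Ψ)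
  have key : ∀ {v : Ty₂ A → ℤ} {Ψ₁ Ψ₂ : CMF G c}, v ∈ hodge₂ A →
      (tr D v - pair c Ψ₁ - pair c Ψ₂) ∈ (hodge₂ A).map (tr D : (Ty₂ A → ℤ) →ₗ[ℤ] (CMF G c →₀ ℤ)) ⊔ Submodule.span ℤ (pairSet c) :=
    fun hv => Submodule.sub_mem _ (Submodule.sub_mem _ (Submodule.mem_sup_left ⟨_, hv, rfl⟩) (Submodule.mem_sup_right (hP _)))
      (Submodule.mem_sup_right (hP _))
  obtain ⟨a, rfl | rfl⟩ := D.exhaust t <;> obtain ⟨b, rfl | rfl⟩ := D.exhaust t'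
  · have hij : a.2 ≠ b.2 := fun h => ht' ((ι_mem_orb_ι_iff D a b).mpr h.symm)
    have e := tr_faceVec₀ D hc2 a b (ty D Φ).1 (ty D Φ).2
    rw [← hΦ] at e
    have e' : gface c hc2 Φ (D.ι a) (D.ι b) = tr D (faceVec₀ A (ty D Φ).1 a.2 b.2 (ty D Φ).2) -
        pair c (typeOf D ((ty D Φ).1 + δ A a.2, (ty D Φ).2)) - pair c (typeOf D ((ty D Φ).1 + δ A b.2, (ty D Φ).2)) := by
      rw [e]; abel
    rw [e']
    exact key (faceVec₀_mem A _ hij _)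
  · have e := tr_faceVecM D hc2 a b (ty D Φ).1 (ty D Φ).2
    rw [← hΦ] at e
    have e' : gface c hc2 Φ (D.ι a) (D.x * D.ι b) = tr D (faceVecM A (ty D Φ).1 a.2 (ty D Φ).2 b.2) -
        pair c (typeOf D ((ty D Φ).1 + δ A a.2, (ty D Φ).2)) - pair c (typeOf D ((ty D Φ).1, (ty D Φ).2 + δ A b.2)) := by
      rw [e]; abel
    rw [e']
    exact key (faceVecM_mem A _ _ _ _)
  · have e := tr_faceVecM' D hc2 b a (ty D Φ).1 (ty D Φ).2
    rw [← hΦ] at e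
    have e' : gface c hc2 Φ (D.x * D.ι a) (D.ι b) = tr D (faceVecM A (ty D Φ).1 b.2 (ty D Φ).2 a.2) -
        pair c (typeOf D ((ty D Φ).1 + δ A b.2, (ty D Φ).2)) - pair c (typeOf D ((ty D Φ).1, (ty D Φ).2 + δ A a.2)) := by
      rw [e]; abel
    rw [e']
    exact key (faceVecM_mem A _ _ _ _)
  · have hij : a.2 ≠ b.2 := fun h => ht' ((xι_mem_orb_xι_iff D a b).mpr h.symm)
    have e := tr_faceVec₁ D hc2 a b (ty D Φ).1 (ty D Φ).2
    rw [← hΦ] at e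
    have e' : gface c hc2 Φ (D.x * D.ι a) (D.x * D.ι b) = tr D (faceVec₁ A (ty D Φ).1 (ty D Φ).2 a.2 b.2) -
        pair c (typeOf D ((ty D Φ).1, (ty D Φ).2 + δ A a.2)) - pair c (typeOf D ((ty D Φ).1, (ty D Φ).2 + δ A b.2)) := by
      rw [e]; abel
    rw [e']
    exact key (faceVec₁_mem A _ _ hij)

/-- **The abstract face attached to a model face class** (a `0`-coordinate or `1`-coordinate square at two distinct places or a mixed square; a
choice of presentation; junk `0` otherwise). [folklore] -/
def gfOf (hc2 : c * c = 1) (f : Ty₂ A → ℤ) : CMF G c →₀ ℤ :=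
  if h₀ : ∃ q : Ty A × A × A × Ty A, q.2.1 ≠ q.2.2.1 ∧ f = faceVec₀ A q.1 q.2.1 q.2.2.1 q.2.2.2 then
    gface c hc2 (typeOf D (h₀.choose.1, h₀.choose.2.2.2)) (D.ι (0, h₀.choose.2.1)) (D.ι (0, h₀.choose.2.2.1))
  else if h₁ : ∃ q : Ty A × Ty A × A × A, q.2.2.1 ≠ q.2.2.2 ∧ f = faceVec₁ A q.1 q.2.1 q.2.2.1 q.2.2.2 then
    gface c hc2 (typeOf D (h₁.choose.1, h₁.choose.2.1)) (D.x * D.ι (0, h₁.choose.2.2.1)) (D.x * D.ι (0, h₁.choose.2.2.2))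
  else if hM : ∃ q : Ty A × A × Ty A × A, f = faceVecM A q.1 q.2.1 q.2.2.1 q.2.2.2 then
    gface c hc2 (typeOf D (hM.choose.1, hM.choose.2.2.1)) (D.ι (0, hM.choose.2.1)) (D.x * D.ι (0, hM.choose.2.2.2))
  else 0

/-- **The attached abstract face is an abstract face, and differs from the transported class by pairs** (for a face class of one of the three
shapes). [folklore] -/
theorem gfOf_spec (hc2 : c * c = 1) {f : Ty₂ A → ℤ}
    (hf : (∃ (φ : Ty A) (i j : A) (ψ : Ty A), i ≠ j ∧ (f = faceVec₀ A φ i j ψ ∨ f = faceVec₁ A ψ φ i j)) ∨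
      ∃ (φ : Ty A) (i : A) (ψ : Ty A) (j : A), f = faceVecM A φ i ψ j) :
    gfOf D hc2 f ∈ gfaceSet G c hc2 ∧ tr D f - gfOf D hc2 f ∈ Submodule.span ℤ (pairSet c) := by
  have hP : ∀ Ψ : CMF G c, pair c Ψ ∈ Submodule.span ℤ (pairSet c) := fun Ψ => Submodule.subset_span (pair_mem_pairSet c Ψ)
  have key3 : ∀ x y z : CMF G c →₀ ℤ, x + y + z - x = y + z := fun x y z => by abel
  by_cases h₀ : ∃ q : Ty A × A × A × Ty A, q.2.1 ≠ q.2.2.1 ∧ f = faceVec₀ A q.1 q.2.1 q.2.2.1 q.2.2.2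
  · rw [gfOf, dif_pos h₀]
    obtain ⟨hq, hfq⟩ := h₀.choose_spec
    refine ⟨⟨_, _, _, fun h => hq ((ι_mem_orb_ι_iff D _ _).mp h).symm, rfl⟩, ?_⟩
    have e := tr_faceVec₀ D hc2 (0, h₀.choose.2.1) (0, h₀.choose.2.2.1) h₀.choose.1 h₀.choose.2.2.2
    rw [← hfq] at e
    rw [e, key3]
    exact Submodule.add_mem _ (hP _) (hP _)
  by_cases h₁ : ∃ q : Ty A × Ty A × A × A, q.2.2.1 ≠ q.2.2.2 ∧ f = faceVec₁ A q.1 q.2.1 q.2.2.1 q.2.2.2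
  · rw [gfOf, dif_neg h₀, dif_pos h₁]
    obtain ⟨hq, hfq⟩ := h₁.choose_spec
    refine ⟨⟨_, _, _, fun h => hq ((xι_mem_orb_xι_iff D _ _).mp h).symm, rfl⟩, ?_⟩
    have e := tr_faceVec₁ D hc2 (0, h₁.choose.2.2.1) (0, h₁.choose.2.2.2) h₁.choose.1 h₁.choose.2.1
    rw [← hfq] at e
    rw [e, key3]
    exact Submodule.add_mem _ (hP _) (hP _)
  by_cases hM : ∃ q : Ty A × A × Ty A × A, f = faceVecM A q.1 q.2.1 q.2.2.1 q.2.2.2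
  · rw [gfOf, dif_neg h₀, dif_neg h₁, dif_pos hM]
    have hfq := hM.choose_spec
    refine ⟨⟨_, _, _, xι_not_mem_orb_ι D _ _, rfl⟩, ?_⟩
    have e := tr_faceVecM D hc2 (0, hM.choose.2.1) (0, hM.choose.2.2.2) hM.choose.1 hM.choose.2.2.1
    rw [← hfq] at e
    rw [e, key3]
    exact Submodule.add_mem _ (hP _) (hP _)
  exfalso
  rcases hf with ⟨φ, i, j, ψ, hij, rfl | rfl⟩ | ⟨φ, i, ψ, j, rfl⟩
  · exact h₀ ⟨(φ, i, j, ψ), hij, rfl⟩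
  · exact h₁ ⟨(ψ, φ, i, j), hij, rfl⟩
  · exact hM ⟨(φ, i, ψ, j), rfl⟩

/-! ## §5 Blocks -/

omit [DecidableEq A] in
/-- **Same block in `(G, c)` ↔ same block in the model.** [folklore] -/
theorem exists_rt_iff_reach (Ψ Ψ' : CMF G c) :
    (∃ Q : G, rt c Q Ψ = Ψ') ↔ ∃ g : ZMod 2 × A, twH A g (ty D Ψ) = ty D Ψ' ∨ twH A g (twX A (ty D Ψ)) = ty D Ψ' := by
  constructor
  · rintro ⟨Q, rfl⟩
    obtain ⟨a, rfl | rfl⟩ := D.exhaust Q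
    · exact ⟨a, Or.inl (ty_rt_ι D a Ψ).symm⟩
    · refine ⟨(a.1, -a.2), Or.inr ?_⟩
      rw [ty_rt_xι, twX_twH]
  · rintro ⟨g, h | h⟩
    · exact ⟨D.ι g, ty_injective D (by rw [ty_rt_ι, h])⟩
    · exact ⟨D.ι g * D.x, ty_injective D (by rw [rt_mul, ty_rt_ι, ty_rt_x, h])⟩

/-- **The blocks of `(G, c)` are the blocks of the model**: `Block c ≃ Block A`. [folklore] -/
def blockEquiv : BlockParity.Block c ≃ Block A :=
  Quotient.congr (typeEquiv D) fun Ψ Ψ' => exists_rt_iff_reach D Ψ Ψ'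

include D in
/-- **`β(G, c) = #Block A`.** [folklore] -/
theorem card_block_eq : Fintype.card (BlockParity.Block c) = Fintype.card (Block A) := Fintype.card_congr (blockEquiv D)

/-! ## §6 The transported count -/

/-- The transported Hodge lattice of the model lies in pairs plus the base changes of the attached abstract faces of the family (`|A|` odd `≥ 3`).
[folklore] -/
theorem map_hodge₂_le (hc2 : c * c = 1) (hA : Odd (Fintype.card A)) (h3 : 3 ≤ Fintype.card A) :
    (hodge₂ A).map (tr D : (Ty₂ A → ℤ) →ₗ[ℤ] (CMF G c →₀ ℤ)) ≤
      Submodule.span ℤ (pairSet c) ⊔ Submodule.span ℤ (translates c ((family A).image (gfOf D hc2))) := by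
  rw [← sup_familySpan_eq_hodge₂ A hA h3, Submodule.map_sup, map_pairs₂]
  refine sup_le le_sup_left ?_
  rw [familySpan, Submodule.map_span, Submodule.span_le]
  rintro _ ⟨v, ⟨f, hf, g, hv⟩, rfl⟩
  obtain ⟨hS, hp⟩ := gfOf_spec D hc2 (family_shape A h3 hf)
  have hmem : gfOf D hc2 f ∈ (family A).image (gfOf D hc2) := Finset.mem_image_of_mem _ hf
  have hdec : ∀ Q : G, Finsupp.mapDomain (rt c Q) (tr D f) ∈
      Submodule.span ℤ (pairSet c) ⊔ Submodule.span ℤ (translates c ((family A).image (gfOf D hc2))) := fun Q => by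
    have e : tr D f = gfOf D hc2 f + (tr D f - gfOf D hc2 f) := by abel
    rw [e, Finsupp.mapDomain_add]
    exact Submodule.add_mem _ (Submodule.mem_sup_right (Submodule.subset_span ⟨Q, _, hmem, rfl⟩))
      (Submodule.mem_sup_left (mapDomain_rt_mem_span_pairSet D Q hp))
  rcases hv with rfl | rfl
  · rw [LinearEquiv.coe_coe, tr_translH]; exact hdec _
  · rw [LinearEquiv.coe_coe, tr_translH_translX]; exact hdec _

include D in
/-- **THE DICYCLIC COUNT IN THE INTRINSIC CURRENCY: `μ(G, c) ≤ β(G, c) − 1`.**  For `(G, c)` carrying a dicyclic datum over an abelian group `A` of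
odd order `≥ 3` there is a finite set `S'` of abstract rank-four faces with `|S'| + 1 ≤ #Block c` whose base changes, together with the pairs, span
`hodgeSpan c`. [folklore] -/
theorem exists_gfaces_generate (hc2 : c * c = 1) (hA : Odd (Fintype.card A)) (h3 : 3 ≤ Fintype.card A) :
    ∃ S' : Finset (CMF G c →₀ ℤ), ↑S' ⊆ gfaceSet G c hc2 ∧ S'.card + 1 ≤ Fintype.card (BlockParity.Block c) ∧
      hodgeSpan c hc2 ≤ Submodule.span ℤ (pairSet c) ⊔ Submodule.span ℤ (translates c S') := by
  refine ⟨(family A).image (gfOf D hc2), ?_, ?_, ?_⟩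
  · intro y hy
    obtain ⟨f, hf, rfl⟩ := Finset.mem_image.mp (Finset.mem_coe.mp hy)
    exact (gfOf_spec D hc2 (family_shape A h3 hf)).1
  · have h1 := card_family_add_one_le A hA h3
    have h2 := Finset.card_image_le (s := family A) (f := gfOf D hc2)
    rw [card_block_eq D]
    omega
  · refine sup_le (Submodule.span_le.mpr ?_) le_sup_left
    rintro y ⟨Φ, t, t', ht', rfl⟩
    have h := gface_mem D hc2 Φ ht' (A := A)
    exact (sup_le (map_hodge₂_le D hc2 hA h3) le_sup_left) h

/-! ## §7 The floor (seat b09's block parities) and the law -/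

omit [Fintype A] [DecidableEq A] in
/-- Block parities kill `ℤ⟨pairSet⟩`. [folklore] -/
theorem par_eq_zero_of_mem_span_pairSet {y : CMF G c →₀ ℤ} (hy : y ∈ Submodule.span ℤ (pairSet c)) : par c y = 0 := by
  refine Submodule.span_induction (p := fun w _ => par c w = 0) ?_ (map_zero _) (fun x y _ _ hx hy => by rw [map_add, hx, hy, add_zero])
    (fun n x _ hx => by rw [map_zsmul, hx, smul_zero]) hy
  rintro _ ⟨Ψ, rfl⟩
  exact par_pair c Ψ

omit [DecidableEq G] [DecidableEq A] in
/-- **The twisting element has `x^{|G|/2} = c ≠ 1`** (`|G|/2 = 2|A|`, `x² = c`, `|A|` odd). [folklore] -/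
theorem x_pow_ne_one (hA : Odd (Fintype.card A)) : D.x ^ (Fintype.card G / 2) ≠ 1 := by
  obtain ⟨k, hk⟩ := hA
  have h2 : Fintype.card G / 2 = 2 * Fintype.card A := by rw [card_eq_four_mul D]; omega
  have hx2 : D.x ^ 2 = c := by rw [pow_two, D.x_mul_x]
  have hcc : c * c = 1 := by
    have h := (D.map_add (1, 0) (1, 0)).symm
    rwa [D.map_c, Prod.mk_add_mk, add_zero, show (1 : ZMod 2) + 1 = 0 by decide, show ((0 : ZMod 2), (0 : A)) = 0 from rfl,
      ι_zero] at h
  have hc2' : c ^ 2 = 1 := by rw [pow_two, hcc]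
  rw [h2, pow_mul, hx2, hk, pow_succ, pow_mul, hc2', one_pow, one_mul]
  -- `c ≠ 1` along the datum: `ι (1,0) = c`, `ι 0 = 1`, `ι` injective
  intro h
  have h1 : D.ι (1, 0) = D.ι 0 := D.map_c.trans (h.trans (ι_zero D).symm)
  have h3 : (1 : ZMod 2) = 0 := congrArg Prod.fst (D.inj h1)
  exact absurd h3 (by decide)

omit [DecidableEq A] in
include D in
/-- **FLOOR: `β(G, c) ≤ |S| + 1`** for every family `S` whose base changes, together with the pairs, generate the abstract faces (seat b09's
`BlockParity.card_block_le_card_add` with `wdelta = 0` by `BlockParity.wdelta_eq_zero_of_pow_ne_one` at the twisting element). [folklore] -/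
theorem card_block_le_card_add_one (hc2 : c * c = 1) (hA : Odd (Fintype.card A)) (S : Finset (CMF G c →₀ ℤ))
    (hS : gfaceSet G c hc2 ⊆ ↑(Submodule.span ℤ (pairSet c) ⊔ Submodule.span ℤ (translates c S))) :
    Fintype.card (BlockParity.Block c) ≤ S.card + 1 := by
  have h := BlockParity.card_block_le_card_add c hc2 (typeOf D 0) S (Submodule.span ℤ (pairSet c))
    (fun y hy => par_eq_zero_of_mem_span_pairSet hy) hS
  have hc1 : c ≠ 1 := fun h => by
    have h1 : D.ι (1, 0) = D.ι 0 := D.map_c.trans (h.trans (ι_zero D).symm)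
    have h3 : (1 : ZMod 2) = 0 := congrArg Prod.fst (D.inj h1)
    exact absurd h3 (by decide)
  rw [BlockParity.wdelta_eq_zero_of_pow_ne_one c hc2 hc1 (mul_c_comm D) (typeOf D 0) (x_pow_ne_one D hA)] at h
  omega

include D in
/-- **THE DICYCLIC LAW IN THE INTRINSIC CURRENCY: `μ(G, c) = β(G, c) − 1`.**  For `(G, c)` carrying a dicyclic datum over an abelian group of odd
order `≥ 3`, the least number of abstract rank-four faces whose base changes, together with the pairs, span `hodgeSpan c` is EXACTLY `#Block c − 1`.
[folklore] -/
theorem isLeast_card_gfaces_generate (hc2 : c * c = 1) (hA : Odd (Fintype.card A)) (h3 : 3 ≤ Fintype.card A) :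
    IsLeast {m : ℕ | ∃ S : Finset (CMF G c →₀ ℤ), ↑S ⊆ gfaceSet G c hc2 ∧ S.card = m ∧
      hodgeSpan c hc2 ≤ Submodule.span ℤ (pairSet c) ⊔ Submodule.span ℤ (translates c S)} (Fintype.card (BlockParity.Block c) - 1) := by
  constructor
  · obtain ⟨S, hS, hcard, hgen⟩ := exists_gfaces_generate D hc2 hA h3
    have hfloor := card_block_le_card_add_one D hc2 hA S (fun y hy => hgen (gfaceSet_subset_hodgeSpan c hc2 hy))
    exact ⟨S, hS, by omega, hgen⟩
  · rintro m ⟨S, -, rfl, hgen⟩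
    have hfloor := card_block_le_card_add_one D hc2 hA S (fun y hy => hgen (gfaceSet_subset_hodgeSpan c hc2 hy))
    omega

include D in
/-- **Exact family**: `S ⊆ gfaceSet` with `|S| + 1 = #Block c` generating. [folklore] -/
theorem exists_gfaces_generate_card_eq (hc2 : c * c = 1) (hA : Odd (Fintype.card A)) (h3 : 3 ≤ Fintype.card A) :
    ∃ S : Finset (CMF G c →₀ ℤ), ↑S ⊆ gfaceSet G c hc2 ∧ S.card + 1 = Fintype.card (BlockParity.Block c) ∧
      hodgeSpan c hc2 ≤ Submodule.span ℤ (pairSet c) ⊔ Submodule.span ℤ (translates c S) := by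
  obtain ⟨S, hS, hcard, hgen⟩ := exists_gfaces_generate D hc2 hA h3
  have hfloor := card_block_le_card_add_one D hc2 hA S (fun y hy => hgen (gfaceSet_subset_hodgeSpan c hc2 hy))
  exact ⟨S, hS, by omega, hgen⟩

end

end Summit.HodgeConjecture.CorCM.Census.DicyclicTwist
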